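import Mathlib.Algebra.BigOperators.Ring.Finset
import Mathlib.Algebra.BigOperators.Intervals
import Mathlib.Algebra.BigOperators.Fin
import Mathlib.Tactic.Ring
import HarnessLib

/-!
# Evaluating a Kronecker power of a decomposed tensor: the level tables of the bilinear algorithm

Topic `Computability/AlgebraicComplexity`. Fifth instalment of the proof of
`Literature.Computability.AlgebraicComplexity.pratt2024_thm_1_9` (K. Pratt, STOC 2024, Thm. 1.9
[Pratt2024SCC]): the arithmetic core of "by assumption, this evaluation [of a restriction of
`T_k^{⊗r}`] can be done using `O((R̃(T_k)+ε/2)^r)` field operations" (§2, proof of Thm. 1.9), i.e.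
the classical fact that a decomposition of a tensor `D` into `R` triads yields an evaluation of the
trilinear form `D^{⊗q}` in `O(q · N · max(R,N)^q)` operations (Bürgisser–Clausen–Shokrollahi,
*Algebraic Complexity Theory*, Prop. (15.26) is the bilinear-map form; Pratt p. 3: "if `T` is
concise then `R̃(T) ≤ x` implies that … one can compute `T^{⊗r}` using `O((x+ε)^r)` arithmetic
operations").

Everything is stated over FLAT indices — naturals below `N^q`, `R^q`, read through their
little-endian digits `digit b s v = v / b^s % b` — because this is the form in which the word-RAM
program of the later instalments stores its arrays (cell `base_j + P · N^{q-j} + A` holds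
`contractLevel … j P A`). For a coefficient table `U i d` (`i < R`, `d < N`) and a vector
`x : ℕ → S` on `[N^q]`:

* `contractLevel N R q U x j P A` — the level-`j` table of the algorithm: level `0` is `x`, and
  level `j + 1` contracts one more digit,
  `contractLevel (j+1) P A = ∑_{d<N} U (P % R) d * contractLevel j (P / R) (d · N^{q-j-1} + A)`
  (`P < R^{j+1}` a string of `j + 1` contraction indices, `A < N^{q-j-1}` the untouched digits);
* `contractLevel_eq` — its closed form
  `∑_{a<N^j} (∏_{s<j} U (digit R s P) (digit N s a)) · x (a · N^{q-j} + A)`;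
* **`sum_contractLevel_mul_eq`** — the algorithm is correct: if
  `Dt d e f = ∑_{i<R} U i d · V i e · W i f` on `[N]³` then
  `∑_{P<R^q} X_q(P) Y_q(P) Z_q(P) = ∑_{a,b,c<N^q} (∏_{s<q} Dt (digit s a) (digit s b) (digit s c)) · x a · y b · z c`,
  the value of the trilinear form `Dt^{⊗q}` at `(x, y, z)` in flat coordinates
  (`sum_prod_digit`: `∑_{P<R^q} ∏_{s<q} f s (digit R s P) = ∏_{s<q} ∑_{i<R} f s i`);
* `prod_ite_digit` — for a scaled `0/1` tensor `Dt = c · [Trip]` the weight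
  `∏_{s<q} Dt(…)` is `c^q` on digitwise-supported triples and `0` elsewhere.

No tensors, ranks or machines are mentioned in this file; it is `CommSemiring` algebra.

## References

* [Pratt2024SCC] K. Pratt, *A stronger connection between the asymptotic rank conjecture and the
  set cover conjecture*, Proc. 56th STOC (2024), arXiv:2311.02774 — §1.1 (p. 3), §2 (proof of
  Thm. 1.9).
* [BurgisserClausenShokrollahi1997] P. Bürgisser, M. Clausen, M. A. Shokrollahi, *Algebraic
  Complexity Theory*, Springer 1997 — §15.5, Prop. (15.26) (fast evaluation of powers from a
  bilinear algorithm).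
-/

namespace Literature.Computability.AlgebraicComplexity

open Finset

open scoped BigOperators

/-! ## Little-endian digits -/

/-- The digit of weight `b^s` of `v` in base `b` (little-endian position `s`). [folklore] -/
def digit (b s v : ℕ) : ℕ := v / b ^ s % b

/-- Unfolding `digit`. [folklore] -/
theorem digit_def (b s v : ℕ) : digit b s v = v / b ^ s % b := rfl

/-- Digits are below the base. [folklore] -/
theorem digit_lt {b : ℕ} (hb : 0 < b) (s v : ℕ) : digit b s v < b := Nat.mod_lt _ hb

/-- The lowest digit is the remainder. [folklore] -/
theorem digit_zero (b v : ℕ) : digit b 0 v = v % b := by simp [digit]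

/-- Higher digits are the digits of the quotient. [folklore] -/
theorem digit_succ (b s v : ℕ) : digit b (s + 1) v = digit b s (v / b) := by
  unfold digit
  rw [pow_succ', ← Nat.div_div_eq_div_mul]

/-- The lowest digit of `a · b + d` (`d < b`) is `d`. [folklore] -/
theorem digit_mul_add_zero {b d : ℕ} (hd : d < b) (a : ℕ) : digit b 0 (a * b + d) = d := by
  rw [digit_zero, Nat.mul_add_mod_of_lt hd]

/-- The higher digits of `a · b + d` (`d < b`) are the digits of `a`. [folklore] -/
theorem digit_mul_add_succ {b d : ℕ} (hd : d < b) (a s : ℕ) :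
    digit b (s + 1) (a * b + d) = digit b s a := by
  rw [digit_succ]
  congr 1
  have hb : 0 < b := lt_of_le_of_lt (Nat.zero_le d) hd
  rw [Nat.mul_comm, Nat.mul_add_div hb, Nat.div_eq_of_lt hd, Nat.add_zero]

/-- **Grouping digits**: digit `t < m` in base `C` of digit `s` in base `C^m` is digit `s · m + t`
in base `C` (a string of `q` digits in base `N = C^m` is a string of `m q` digits in base `C`,
read in blocks of `m`). [folklore] -/
theorem digit_digit_pow {C m t : ℕ} (ht : t < m) (s a : ℕ) :
    digit C t (digit (C ^ m) s a) = digit C (s * m + t) a := by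
  unfold digit
  obtain ⟨e, rfl⟩ := Nat.exists_eq_add_of_lt ht
  rw [← pow_mul, show t + e + 1 = t + (e + 1) by ring, pow_add C t (e + 1),
    Nat.mod_mul_right_div_self, Nat.mod_mod_of_dvd _ (dvd_pow_self C (Nat.succ_ne_zero e)),
    Nat.div_div_eq_div_mul, ← pow_add, Nat.mul_comm (t + (e + 1)) s]

/-- `a · b + d < m · b` for `a < m`, `d < b` (the index arithmetic of two nested loops). [folklore] -/
theorem mul_add_lt_mul {a b d m : ℕ} (ha : a < m) (hd : d < b) : a * b + d < m * b := by
  calc a * b + d < a * b + b := Nat.add_lt_add_left hd _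
    _ = (a + 1) * b := by ring
    _ ≤ m * b := Nat.mul_le_mul_right _ ha

/-- Splitting a sum over `[m · n]` along `v = a · n + d`. [folklore] -/
theorem sum_range_mul_eq {M : Type*} [AddCommMonoid M] (m n : ℕ) (g : ℕ → M) :
    ∑ v ∈ range (m * n), g v = ∑ d ∈ range n, ∑ a ∈ range m, g (a * n + d) := by
  induction m with
  | zero => simp
  | succ m ih =>
    rw [Nat.succ_mul, sum_range_add, ih, ← sum_add_distrib]
    refine sum_congr rfl fun d _ => ?_
    rw [sum_range_succ]

/-! ## The level tables -/

section Levels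

variable {S : Type*} [CommSemiring S]

/-- **The level tables of the bilinear evaluation algorithm.** For a coefficient table `U i d`
(`i < R` a triad index, `d < N` a coordinate) and an input vector `x` on `[N^q]`: level `0` is
`x`; level `j + 1` at contraction string `P < R^{j+1}` and free index `A < N^{q-j-1}` contracts the
leading remaining digit against the triad `P % R`:
`∑_{d<N} U (P % R) d · level j (P / R) (d · N^{q-j-1} + A)`. (BCS Prop. (15.26); Pratt §2.)
[cite: BurgisserClausenShokrollahi1997, Prop. 15.26] -/
def contractLevel (N R q : ℕ) (U : ℕ → ℕ → S) (x : ℕ → S) : ℕ → ℕ → ℕ → S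
  | 0, _, A => x A
  | j + 1, P, A => ∑ d ∈ range N,
      U (P % R) d * contractLevel N R q U x j (P / R) (d * N ^ (q - (j + 1)) + A)

/-- Level `0` is the input. [folklore] -/
@[simp] theorem contractLevel_zero (N R q : ℕ) (U : ℕ → ℕ → S) (x : ℕ → S) (P A : ℕ) :
    contractLevel N R q U x 0 P A = x A := rfl

/-- The recurrence of the level tables. [folklore] -/
theorem contractLevel_succ (N R q : ℕ) (U : ℕ → ℕ → S) (x : ℕ → S) (j P A : ℕ) :
    contractLevel N R q U x (j + 1) P A = ∑ d ∈ range N,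
      U (P % R) d * contractLevel N R q U x j (P / R) (d * N ^ (q - (j + 1)) + A) := rfl

/-- The level tables commute with ring homomorphisms (used with `ℤ → ZMod (2^w)`: the word RAM
computes the tables of the integer data modulo the word size). [folklore] -/
theorem map_contractLevel {S' : Type*} [CommSemiring S'] (f : S →+* S') (N R q : ℕ)
    (U : ℕ → ℕ → S) (x : ℕ → S) :
    ∀ j P A, f (contractLevel N R q U x j P A) =
      contractLevel N R q (fun i d => f (U i d)) (fun a => f (x a)) j P A
  | 0, P, A => rfl
  | j + 1, P, A => by
    rw [contractLevel_succ, contractLevel_succ, map_sum]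
    refine sum_congr rfl fun d _ => ?_
    rw [map_mul, map_contractLevel f N R q U x j]

/-- The coefficient of `x (a · N^{q-j} + A)` in level `j` at `P`: the product of the table entries
along the digits of `P` (base `R`) and `a` (base `N`). [folklore] -/
def digitCoeff (N R : ℕ) (U : ℕ → ℕ → S) (j P a : ℕ) : S :=
  ∏ s ∈ range j, U (digit R s P) (digit N s a)

/-- `digitCoeff` at `j = 0` is `1`. [folklore] -/
@[simp] theorem digitCoeff_zero (N R : ℕ) (U : ℕ → ℕ → S) (P a : ℕ) : digitCoeff N R U 0 P a = 1 := by
  simp [digitCoeff]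

/-- Peeling the lowest digits off `digitCoeff`. [folklore] -/
theorem digitCoeff_succ (N R : ℕ) (U : ℕ → ℕ → S) (j P a : ℕ) {d : ℕ} (hd : d < N) :
    digitCoeff N R U (j + 1) P (a * N + d) = U (P % R) d * digitCoeff N R U j (P / R) a := by
  unfold digitCoeff
  rw [prod_range_succ', digit_mul_add_zero hd, digit_zero, mul_comm]
  congr 1
  exact prod_congr rfl fun s _ => by rw [digit_mul_add_succ hd, digit_succ]

/-- **Closed form of the level tables**: for `j ≤ q`,
`level j P A = ∑_{a<N^j} digitCoeff j P a · x (a · N^{q-j} + A)`. [folklore] -/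
theorem contractLevel_eq (N R q : ℕ) (U : ℕ → ℕ → S) (x : ℕ → S) :
    ∀ j, j ≤ q → ∀ P A, contractLevel N R q U x j P A =
      ∑ a ∈ range (N ^ j), digitCoeff N R U j P a * x (a * N ^ (q - j) + A)
  | 0, _, P, A => by simp
  | j + 1, hj, P, A => by
    rw [contractLevel_succ, pow_succ, sum_range_mul_eq]
    refine sum_congr rfl fun d hd => ?_
    rw [mem_range] at hd
    rw [contractLevel_eq N R q U x j (Nat.le_of_succ_le hj), mul_sum]
    refine sum_congr rfl fun a _ => ?_
    rw [digitCoeff_succ N R U j P a hd, mul_assoc]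
    congr 2
    have hq : q - j = q - (j + 1) + 1 := by omega
    rw [hq, pow_succ]
    ring

/-- The last level (`j = q`, `A = 0`): `level q P 0 = ∑_{a<N^q} digitCoeff q P a · x a`. [folklore] -/
theorem contractLevel_last (N R q : ℕ) (U : ℕ → ℕ → S) (x : ℕ → S) (P : ℕ) :
    contractLevel N R q U x q P 0 = ∑ a ∈ range (N ^ q), digitCoeff N R U q P a * x a := by
  rw [contractLevel_eq N R q U x q le_rfl]
  simp

/-- **Summing a digitwise product over all digit strings**:
`∑_{P<R^q} ∏_{s<q} f s (digit R s P) = ∏_{s<q} ∑_{i<R} f s i`. [folklore] -/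
theorem sum_prod_digit (R : ℕ) : ∀ (q : ℕ) (f : ℕ → ℕ → S),
    ∑ P ∈ range (R ^ q), ∏ s ∈ range q, f s (digit R s P) = ∏ s ∈ range q, ∑ i ∈ range R, f s i
  | 0, f => by simp
  | q + 1, f => by
    rw [pow_succ, sum_range_mul_eq, prod_range_succ', mul_comm, sum_mul]
    refine sum_congr rfl fun i hi => ?_
    rw [mem_range] at hi
    rw [← sum_prod_digit R q (fun s => f (s + 1)), mul_sum]
    refine sum_congr rfl fun P _ => ?_
    rw [prod_range_succ', digit_mul_add_zero hi, mul_comm]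
    congr 1
    exact prod_congr rfl fun s _ => by rw [digit_mul_add_succ hi]

/-- The product of the three coefficient strings at a common `P` is a digitwise product. [folklore] -/
theorem digitCoeff_mul_mul (N R : ℕ) (U V W : ℕ → ℕ → S) (q P a b c : ℕ) :
    digitCoeff N R U q P a * digitCoeff N R V q P b * digitCoeff N R W q P c =
      ∏ s ∈ range q, (U (digit R s P) (digit N s a) * V (digit R s P) (digit N s b) *
        W (digit R s P) (digit N s c)) := by
  unfold digitCoeff
  rw [prod_mul_distrib, prod_mul_distrib]

/-- **Correctness of the bilinear evaluation algorithm** (flat form of BCS Prop. (15.26); the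
"evaluation using `O((R̃+ε/2)^r)` operations" of Pratt's proof): if the table `(U, V, W)` is a
decomposition of the base tensor `Dt` on `[N]³` into `R` triads, then the sum over all contraction
strings `P < R^q` of the products of the three last-level tables equals the trilinear form
`Dt^{⊗q}` evaluated at `(x, y, z)`, written in flat coordinates through digits.
[cite: BurgisserClausenShokrollahi1997, Prop. 15.26] -/
theorem sum_contractLevel_mul_eq (N R q : ℕ) (U V W : ℕ → ℕ → S) (Dt : ℕ → ℕ → ℕ → S)
    (hDt : ∀ d e f, d < N → e < N → f < N → Dt d e f = ∑ i ∈ range R, U i d * V i e * W i f)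
    (x y z : ℕ → S) :
    ∑ P ∈ range (R ^ q), contractLevel N R q U x q P 0 * contractLevel N R q V y q P 0 *
        contractLevel N R q W z q P 0 =
      ∑ a ∈ range (N ^ q), ∑ b ∈ range (N ^ q), ∑ c ∈ range (N ^ q),
        (∏ s ∈ range q, Dt (digit N s a) (digit N s b) (digit N s c)) * (x a * y b * z c) := by
  -- expand the three last levels and distribute
  have hexp : ∀ P, contractLevel N R q U x q P 0 * contractLevel N R q V y q P 0 *
      contractLevel N R q W z q P 0 =
      ∑ a ∈ range (N ^ q), ∑ b ∈ range (N ^ q), ∑ c ∈ range (N ^ q),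
        (digitCoeff N R U q P a * digitCoeff N R V q P b * digitCoeff N R W q P c) *
          (x a * y b * z c) := by
    intro P
    rw [contractLevel_last, contractLevel_last, contractLevel_last, sum_mul_sum, sum_mul]
    refine sum_congr rfl fun a _ => ?_
    rw [sum_mul]
    refine sum_congr rfl fun b _ => ?_
    rw [mul_sum]
    refine sum_congr rfl fun c _ => ?_
    ring
  simp_rw [hexp]
  rw [sum_comm]
  refine sum_congr rfl fun a ha => ?_
  rw [sum_comm]
  refine sum_congr rfl fun b hb => ?_
  rw [sum_comm]
  refine sum_congr rfl fun c hc => ?_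
  rw [← sum_mul]
  congr 1
  simp_rw [digitCoeff_mul_mul]
  rw [sum_prod_digit R q (fun s i => U i (digit N s a) * V i (digit N s b) * W i (digit N s c))]
  refine prod_congr rfl fun s hs => ?_
  rw [mem_range] at ha hs
  have hN : 0 < N := Nat.pos_of_ne_zero fun h => by
    subst h
    rw [zero_pow (by omega)] at ha
    exact Nat.not_lt_zero _ ha
  exact (hDt _ _ _ (digit_lt hN _ _) (digit_lt hN _ _) (digit_lt hN _ _)).symm

/-- For a scaled `0/1` base tensor `Dt = c · [Trip]`, the weight of a triple of digit strings is
`c^q` if every digit triple is supported and `0` otherwise. [folklore] -/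
theorem prod_ite_digit (N q : ℕ) (c : S) (Trip : ℕ → ℕ → ℕ → Prop)
    [∀ u v w, Decidable (Trip u v w)] (a b e : ℕ) :
    (∏ s ∈ range q, (if Trip (digit N s a) (digit N s b) (digit N s e) then c else 0)) =
      if ∀ s, s < q → Trip (digit N s a) (digit N s b) (digit N s e) then c ^ q else 0 := by
  rw [prod_ite_zero]
  simp only [mem_range, prod_const, card_range]

end Levels

end Literature.Computability.AlgebraicComplexity
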